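import Mathlib
import Summits.PneNP.PneNP.Theorems.CnfIdealGenLengthRankDefectRepresentationsTwoFamilyCutDomination
import Summits.PneNP.PneNP.Theorems.CnfIdealGenLengthRankDefectRepresentationsAnchorExtrapolation
import Summits.PneNP.PneNP.Theorems.CnfIdealGenLengthRankDefectRepresentationsStripCompletion

/-!
# Crux `RankDefectRepresentations` (stmt-PneNP-18923), line `rank-dehn-ladder`: THE TWO-DIMENSIONAL MAX-CUT DECOMPOSITION WITH A
# CLASS-INDEPENDENT (QUADRATIC) CONSTANT — THEOREM A of the anchor method (lead g11)

`DoubleMaxCutDecomposition K n n′ λ` (`Theorems/…TwoFamilyCutDomination`, p653152) asks: if every double bipartition cut of a matrix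
`D` whose rows and columns are coloured by `{0,1}ⁿ × {0,1}^{n′}` has rank `≤ c`, then `D = S_I + S_J + L` with `S_I` supported on
"first-family colours agree", `S_J` on "second-family colours agree" and `rank L ≤ λ·c`.  Before this file the only class-independent
information was the `n′ = 1` slice (p657204, `λ = 8`) and the trivial `λ ≤ 8·min(2ⁿ, 2^{n′})`; three lead generations (g8–g10) found no
mechanism for growth and no bound.  THEOREM A (`doubleMaxCut_quadratic`): for EVERY field and EVERY `n, n′`,

  all double cuts `≤ c`  ⟹  `D = S_I + S_J + L` with `rank L ≤ c + 160·c²`.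

Proof = ANCHOR EXTRAPOLATION (p677763: a maximal invertible co-rectangular minor `M = D[X₀,Y₀]` has size `r ≤ c`, and by maximality +
Schur complement the rank-`r` matrix `D[·,Y₀] M⁻¹ D[X₀,·]` agrees with `D` at every visible entry off four label strips of `≤ c` classes)
+ STRIP COMPLETION (p677961: the residual, whose double cuts are `≤ 5c`, is visibly supported on the strips, and each strip is a
one-family instance closed by g7's max-cut decomposition, total rank `≤ 32·c·5c`) + the assembly below (`doubleCut` is subadditive and
`≤ 4·rank`).  The bound is QUADRATIC in `c`, so this does NOT close the registered stub `stub_doubleMaxCutDecomposition` (which needs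
`λ(n,n′)·c`, linear in `c` — exactly what the SIM recursion `simBound_sum` consumes); it settles the qualitative question (no growth with
the number of colour classes) and reduces the linear conjecture to "core" instances with `≤ 4c` classes in one family (memo
`Cruxes/RankDefectRepresentations/Lines/rank-dehn-ladder-g11.md`).
HONEST FRAMING: elementary linear algebra; P ≠ NP is not moved; F-N2 is a FRONTIER formal rung.
-/

set_option linter.dupNamespace false -- `Summit.PneNP.PneNP.…`: summit = sub-problem name (D-0017)

namespace Summit.PneNP.PneNP.Theorems.CnfIdealGenLengthRankDefectRepresentationsDoubleMaxCutQuadratic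

open Matrix
open Summit.PneNP.PneNP.Theorems.CnfIdealGenLengthRankDefectRepresentationsTwoFamilyCutDomination
  (colourI colourJ maskJ doubleCut DoubleMaxCutDecomposition)
open Summit.PneNP.PneNP.Theorems.CnfIdealGenLengthRankDefectRepresentationsMergeLowerBound (rank_add_le' rank_sub_le')
open Summit.PneNP.PneNP.Theorems.CnfIdealGenLengthRankDefectRepresentationsAnchorExtrapolation (stub_anchorExtrapolation)
open Summit.PneNP.PneNP.Theorems.CnfIdealGenLengthRankDefectRepresentationsStripCompletion (stub_stripCompletion rank_mask_le)

variable {K : Type} [Field K] {n n' : ℕ} {ι ι' : Type} [Fintype ι] [Fintype ι'] [DecidableEq ι] [DecidableEq ι']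

/-- Visibility in the first family: some I-coordinate differs iff the I-colours differ. -/
theorem exists_ne_inl_iff (r s : Fin n ⊕ Fin n' → Bool) :
    (∃ k, r (Sum.inl k) ≠ s (Sum.inl k)) ↔ colourI r ≠ colourI s := by
  constructor
  · rintro ⟨k, hk⟩ h
    exact hk (congrFun h k)
  · intro h
    by_contra hne
    push Not at hne
    exact h (funext fun k => hne k)

/-- Visibility in the second family: some J-coordinate differs iff the J-colours differ. -/
theorem exists_ne_inr_iff (r s : Fin n ⊕ Fin n' → Bool) :
    (∃ k, r (Sum.inr k) ≠ s (Sum.inr k)) ↔ colourJ r ≠ colourJ s := by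
  constructor
  · rintro ⟨k, hk⟩ h
    exact hk (congrFun h k)
  · intro h
    by_contra hne
    push Not at hne
    exact h (funext fun k => hne k)

omit [DecidableEq ι'] in
/-- Double cuts are subadditive in the matrix: `doubleCut (D - F) ≤ doubleCut D + doubleCut F`. -/
theorem doubleCut_sub_le (row : ι → Fin n ⊕ Fin n' → Bool) (col : ι' → Fin n ⊕ Fin n' → Bool)
    (B : Finset (Fin n → Bool)) (B' : Finset (Fin n' → Bool)) (D F : Matrix ι ι' K) :
    doubleCut row col B B' (D - F) ≤ doubleCut row col B B' D + doubleCut row col B B' F := by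
  classical
  have hJ : maskJ row col B' (D - F) = maskJ row col B' D - maskJ row col B' F := by
    ext x y; simp only [maskJ, Matrix.of_apply, Matrix.sub_apply]; split_ifs <;> simp
  unfold doubleCut
  set MD1 : Matrix ι ι' K :=
    Matrix.of fun x y => if colourI (row x) ∈ B ∧ colourI (col y) ∉ B then maskJ row col B' D x y else 0 with hMD1
  set MF1 : Matrix ι ι' K :=
    Matrix.of fun x y => if colourI (row x) ∈ B ∧ colourI (col y) ∉ B then maskJ row col B' F x y else 0 with hMF1
  set MD2 : Matrix ι ι' K :=
    Matrix.of fun x y => if colourI (row x) ∉ B ∧ colourI (col y) ∈ B then maskJ row col B' D x y else 0 with hMD2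
  set MF2 : Matrix ι ι' K :=
    Matrix.of fun x y => if colourI (row x) ∉ B ∧ colourI (col y) ∈ B then maskJ row col B' F x y else 0 with hMF2
  have h1 : (Matrix.of fun x y =>
        if colourI (row x) ∈ B ∧ colourI (col y) ∉ B then maskJ row col B' (D - F) x y else 0) = MD1 - MF1 := by
    ext x y; simp only [hMD1, hMF1, hJ, Matrix.of_apply, Matrix.sub_apply]; split_ifs <;> simp
  have h2 : (Matrix.of fun x y =>
        if colourI (row x) ∉ B ∧ colourI (col y) ∈ B then maskJ row col B' (D - F) x y else 0) = MD2 - MF2 := by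
    ext x y; simp only [hMD2, hMF2, hJ, Matrix.of_apply, Matrix.sub_apply]; split_ifs <;> simp
  rw [h1, h2]
  have e1 := rank_sub_le' MD1 MF1
  have e2 := rank_sub_le' MD2 MF2
  omega

/-- Each double-cut summand of `F` is a sum of two diagonal-maskings of `F`, so `doubleCut F ≤ 4 · rank F`. -/
theorem doubleCut_le_four_mul_rank (row : ι → Fin n ⊕ Fin n' → Bool) (col : ι' → Fin n ⊕ Fin n' → Bool)
    (B : Finset (Fin n → Bool)) (B' : Finset (Fin n' → Bool)) (F : Matrix ι ι' K) :
    doubleCut row col B B' F ≤ 4 * F.rank := by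
  classical
  unfold doubleCut
  have split : ∀ (pr : ι → Prop) (pc : ι' → Prop) [DecidablePred pr] [DecidablePred pc],
      (Matrix.of fun x y => if pr x ∧ pc y then maskJ row col B' F x y else 0).rank ≤ 2 * F.rank := by
    intro pr pc _ _
    have e : (Matrix.of fun x y => if pr x ∧ pc y then maskJ row col B' F x y else 0) =
        (Matrix.of fun x y => if (pr x ∧ colourJ (row x) ∈ B') ∧ (pc y ∧ colourJ (col y) ∉ B') then F x y else 0) +
        (Matrix.of fun x y => if (pr x ∧ colourJ (row x) ∉ B') ∧ (pc y ∧ colourJ (col y) ∈ B') then F x y else 0) := by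
      ext x y
      simp only [maskJ, Matrix.of_apply, Matrix.add_apply]
      by_cases h1 : pr x <;> by_cases h2 : pc y <;> by_cases h3 : colourJ (row x) ∈ B' <;>
        by_cases h4 : colourJ (col y) ∈ B' <;> simp [h1, h2, h3, h4]
    rw [e, two_mul]
    exact (rank_add_le' _ _).trans (Nat.add_le_add (rank_mask_le _ _ F) (rank_mask_le _ _ F))
  have a1 := split (fun x => colourI (row x) ∈ B) (fun y => colourI (col y) ∉ B)
  have a2 := split (fun x => colourI (row x) ∉ B) (fun y => colourI (col y) ∈ B)
  omega

/-- **THEOREM A — the 2D max-cut decomposition with a class-independent quadratic constant.**  If all double bipartition cuts of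
`D` are `≤ c`, then `D = S_I + S_J + L` with `S_I` supported on "first-family colours agree", `S_J` supported on "second-family colours
agree" and `rank L ≤ c + 160·c²` — for every field and every numbers `n, n′` of coordinates. -/
theorem doubleMaxCut_quadratic (K : Type) [Field K] (n n' : ℕ) (ι ι' : Type) [Fintype ι] [Fintype ι']
    [DecidableEq ι] [DecidableEq ι']
    (row : ι → Fin n ⊕ Fin n' → Bool) (col : ι' → Fin n ⊕ Fin n' → Bool) (D : Matrix ι ι' K) (c : ℕ)
    (hc : ∀ B B', doubleCut row col B B' D ≤ c) :
    ∃ SI SJ : Matrix ι ι' K,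
      (∀ x y, (∃ k, row x (Sum.inl k) ≠ col y (Sum.inl k)) → SI x y = 0) ∧
      (∀ x y, (∃ k', row x (Sum.inr k') ≠ col y (Sum.inr k')) → SJ x y = 0) ∧
      (D - SI - SJ).rank ≤ c + 160 * c ^ 2 := by
  classical
  obtain ⟨F, PI, PI', QJ, QJ', hF, hPI, hPI', hQJ, hQJ', hagree⟩ :=
    stub_anchorExtrapolation K n n' ι ι' row col D c hc
  -- the residual has double cuts ≤ 5c and vanishes at the visible entries off the strips
  have hE : ∀ B B', doubleCut row col B B' (D - F) ≤ 5 * c := by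
    intro B B'
    have h1 := doubleCut_sub_le row col B B' D F
    have h2 := doubleCut_le_four_mul_rank row col B B' F
    have h3 := hc B B'
    have h4 : 4 * F.rank ≤ 4 * c := Nat.mul_le_mul_left 4 hF
    omega
  have hvan : ∀ x y, colourI (row x) ≠ colourI (col y) → colourJ (row x) ≠ colourJ (col y) →
      colourI (row x) ∉ PI → colourJ (row x) ∉ QJ → colourI (col y) ∉ PI' → colourJ (col y) ∉ QJ' →
      (D - F) x y = 0 := by
    intro x y h1 h2 h3 h4 h5 h6
    rw [Matrix.sub_apply, hagree x y h1 h2 h3 h4 h5 h6, sub_self]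
  obtain ⟨L, hL, hLagree⟩ :=
    stub_stripCompletion K n n' ι ι' row col (D - F) (5 * c) c PI PI' QJ QJ' hE hPI hPI' hQJ hQJ' hvan
  -- the leftover `N := D - F - L` vanishes at every visible entry; split it into an I-agree and a J-agree part
  set N : Matrix ι ι' K := D - F - L with hN
  refine ⟨Matrix.of fun x y => if colourI (row x) = colourI (col y) then N x y else 0,
    Matrix.of fun x y => if colourI (row x) ≠ colourI (col y) then N x y else 0, ?_, ?_, ?_⟩
  · intro x y hk
    have h : colourI (row x) ≠ colourI (col y) := (exists_ne_inl_iff (row x) (col y)).1 hk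
    simp [h]
  · intro x y hk
    have hJ : colourJ (row x) ≠ colourJ (col y) := (exists_ne_inr_iff (row x) (col y)).1 hk
    by_cases hI : colourI (row x) = colourI (col y)
    · simp [hI]
    · have : N x y = 0 := by
        rw [hN, Matrix.sub_apply, hLagree x y hI hJ, sub_self]
      simp [this]
  · have hdec : D - (Matrix.of fun x y => if colourI (row x) = colourI (col y) then N x y else 0) -
        (Matrix.of fun x y => if colourI (row x) ≠ colourI (col y) then N x y else 0) = F + L := by
      ext x y
      simp only [hN, Matrix.sub_apply, Matrix.add_apply, Matrix.of_apply]
      by_cases h : colourI (row x) = colourI (col y)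
      · rw [if_pos h, if_neg (fun hne => hne h)]; ring
      · rw [if_neg h, if_pos h]; ring
    rw [hdec]
    calc (F + L).rank ≤ F.rank + L.rank := rank_add_le' F L
      _ ≤ c + 32 * c * (5 * c) := Nat.add_le_add hF hL
      _ = c + 160 * c ^ 2 := by ring

/-- **Corollary (the statement in the `DoubleMaxCutDecomposition` format, for a FIXED cut bound).**  For instances whose double cuts are
bounded by `c₀`, the decomposition holds with the constant `λ = 1 + 160·c₀` — in particular `DoubleMaxCutDecomposition K n n′ λ` restricted
to `c ≤ c₀`; stated here as: all double cuts `≤ c` and `c ≤ c₀` ⟹ `rank L ≤ (1 + 160·c₀)·c`. -/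
theorem doubleMaxCut_of_cut_le (K : Type) [Field K] (n n' : ℕ) (ι ι' : Type) [Fintype ι] [Fintype ι']
    [DecidableEq ι] [DecidableEq ι']
    (row : ι → Fin n ⊕ Fin n' → Bool) (col : ι' → Fin n ⊕ Fin n' → Bool) (D : Matrix ι ι' K) (c c₀ : ℕ)
    (hc : ∀ B B', doubleCut row col B B' D ≤ c) (hc₀ : c ≤ c₀) :
    ∃ SI SJ : Matrix ι ι' K,
      (∀ x y, (∃ k, row x (Sum.inl k) ≠ col y (Sum.inl k)) → SI x y = 0) ∧
      (∀ x y, (∃ k', row x (Sum.inr k') ≠ col y (Sum.inr k')) → SJ x y = 0) ∧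
      (D - SI - SJ).rank ≤ (1 + 160 * c₀) * c := by
  obtain ⟨SI, SJ, h1, h2, h3⟩ := doubleMaxCut_quadratic K n n' ι ι' row col D c hc
  refine ⟨SI, SJ, h1, h2, h3.trans ?_⟩
  have : c ^ 2 ≤ c₀ * c := by rw [sq]; exact Nat.mul_le_mul_right c hc₀
  nlinarith

end Summit.PneNP.PneNP.Theorems.CnfIdealGenLengthRankDefectRepresentationsDoubleMaxCutQuadratic
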